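import Summits.CriticalPhenomena.PercolationContinuityZ3.Theorems.SahiMasterFamilyFCombShiftDet
import Summits.CriticalPhenomena.PercolationContinuityZ3.Theorems.SahiMasterFamilyFCombRelCompression

/-!
# The relative shift-determinant theorem: Kleitman–Hall unimodularity survives down-compression
# RELATIVE to a convex ambient family (THEOREM S^rel; LEMMA I** of the one-shared-coordinate programme — support file)

Support file (prover seat `prim-bnk-2`, gen 31; `--supports stmt-CriticalPhenomena-4575`), companion of THEOREM S
(`SahiFComb.Shift.isUnit_det_incl_downs`, file `…SahiMasterFamilyFCombShiftDet`); relative compression and its split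
lemmas are in `…SahiMasterFamilyFCombRelCompressionDefs` / `…RelCompression`.  Memo:
`run/shared/lean/prim/prim-l12/FROM-prim-bnk-2-g31-COMPRESSION-THEOREM.md` §1.

**THEOREM S^rel (`SahiFComb.Shift.isUnit_det_incl_relDowns`).**  Let `Q` be CONVEX (`F ⊆ K ⊆ G`, `F, G ∈ Q ⟹ K ∈ Q`),
`𝒢 ⊆ Q`, `l` a list of distinct coordinates and `e` any bijection between `𝒢` and the iterated relative compression
`D^Q_l 𝒢`.  Then the integer matrix `([e a ⊆ b])_{a b ∈ 𝒢}` has determinant `±1`.  (`Q = univ`: THEOREM S.)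

Proof: the induction of THEOREM S verbatim — split off the first coordinate `c`; after the column operation
`col(K+c) −= col(K)` (`K ∈ 𝒢⁰ ∩ 𝒢¹`) the matrix is block lower triangular with diagonal blocks of the same shape for
the sections — with ONE extra remark: a column `K + c` with `K ∈ 𝒢¹ ∖ Q` vanishes on the `c`-free rows, because such a
row `F` lies in `Q`, and `F ⊆ K ⊆ K + c ∈ Q` would put `K ∈ Q` by convexity.

Use (memo §1): for up-sets `P ⊆ Q` of a cube, with the duality `det ζ[σP, X] = ± det ζ[X, P]`, THEOREM S^rel gives
`σP ≅↑ D^Q_l P` ("Kleitman–Hall survives relative compression") — the matching half of the explicit solution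
`T = U_l(Q ∖ P)` of LEMMA I** (prim-bnk-2 g30, `PROBLEMS-g30-TWO-LEVEL-KLEITMAN-LEMMAS.md`).  No definitions; no `sorry`;
standard axioms.
-/

namespace Summit.CriticalPhenomena.PercolationContinuityZ3.Theorems

namespace SahiFComb.Shift

open Finset FinsetFamily Matrix

variable {α : Type*} [DecidableEq α]

/-- **THEOREM S^rel** (prim-bnk-2 g31, memo FROM-prim-bnk-2-g31-COMPRESSION-THEOREM.md §1).  For every CONVEX ambient
family `Q` (`F ⊆ K ⊆ G` with `F, G ∈ Q` forces `K ∈ Q`), every subfamily `𝒢 ⊆ Q`, every list `l` of distinct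
coordinates and every bijection `e : 𝒢 ≃ D^Q_l 𝒢` onto the iterated relative down-compression, the square inclusion
matrix `([e a ⊆ b])_{a,b ∈ 𝒢}` has a unit (i.e. `±1`) determinant.  (`Q = univ`: THEOREM S.) [this work] -/
theorem isUnit_det_incl_relDowns [LinearOrder α] :
    ∀ (l : List α), l.Nodup → ∀ (Q : Finset (Finset α)),
      (∀ ⦃F G K : Finset α⦄, F ∈ Q → G ∈ Q → F ⊆ K → K ⊆ G → K ∈ Q) →
      ∀ (𝒢 : Finset (Finset α)), 𝒢 ⊆ Q →
      ∀ (e : (𝒢 : Set (Finset α)) ≃ ↥(l.foldl (fun 𝒴 i => relCompression Q i 𝒴) 𝒢)),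
      IsUnit ((incl (l.foldl (fun 𝒴 i => relCompression Q i 𝒴) 𝒢) 𝒢).submatrix e id).det
  | [], _, Q, _, 𝒢, _, e => by
    have h1 : ((incl 𝒢 𝒢).submatrix (e : ↥𝒢 → ↥𝒢) id).det = Equiv.Perm.sign e * (incl 𝒢 𝒢).det :=
      Matrix.det_permute e (incl 𝒢 𝒢)
    change IsUnit ((incl 𝒢 𝒢).submatrix (e : ↥𝒢 → ↥𝒢) id).det
    rw [h1, det_incl_self, mul_one]
    exact Units.isUnit _
  | c :: l, hl, Q, hQ, 𝒢, h𝒢Q, e₀₀ => by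
    obtain ⟨hcl, hl'⟩ : c ∉ l ∧ l.Nodup := List.nodup_cons.1 hl
    suffices key : ∀ D : Finset (Finset α), D = (c :: l).foldl (fun 𝒴 i => relCompression Q i 𝒴) 𝒢 →
        ∀ e : (𝒢 : Set (Finset α)) ≃ ↥D, IsUnit ((incl D 𝒢).submatrix e id).det from key _ rfl e₀₀
    intro D hD e
    set 𝒢₀ := 𝒢.nonMemberSubfamily c with h𝒢₀
    set 𝒢₁ := 𝒢.memberSubfamily c with h𝒢₁
    set Q₀ := Q.nonMemberSubfamily c with hQ₀
    set Q₁ := Q.memberSubfamily c with hQ₁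
    set U : Finset (Finset α) := 𝒢₀ ∪ {s ∈ 𝒢₁ | s ∈ Q} with hU
    set I : Finset (Finset α) := {s ∈ 𝒢₁ | s ∈ 𝒢 ∨ s ∉ Q} with hI
    set R₀ : Finset (Finset α) := l.foldl (fun 𝒴 i => relCompression Q₀ i 𝒴) U with hR₀
    set R₁ : Finset (Finset α) := l.foldl (fun 𝒴 i => relCompression Q₁ i 𝒴) I with hR₁
    have hD' : D = l.foldl (fun 𝒴 i => relCompression Q i 𝒴) (relCompression Q c 𝒢) := hD
    have hDR₀ : D.nonMemberSubfamily c = R₀ := by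
      rw [hD', nonMemberSubfamily_relDowns l hcl, nonMemberSubfamily_relCompression_self]
    have hDR₁ : D.memberSubfamily c = R₁ := by
      rw [hD', memberSubfamily_relDowns l hcl, memberSubfamily_relCompression_self]
    -- members of `𝒢₀`, `𝒢₁`, `U`, `I`, `R₀`, `R₁` avoid `c`
    have h𝒢₁_c : ∀ K ∈ 𝒢₁, c ∉ K := fun K hK => (mem_memberSubfamily.1 hK).2
    have hU_c : ∀ K ∈ U, c ∉ K := fun K hK => (mem_union.1 hK).elim
      (fun h => (mem_nonMemberSubfamily.1 h).2) (fun h => h𝒢₁_c K (mem_filter.1 h).1)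
    have hI_c : ∀ K ∈ I, c ∉ K := fun K hK => h𝒢₁_c K (mem_filter.1 hK).1
    have hR₀_c : ∀ F ∈ R₀, c ∉ F := fun F hF => (mem_nonMemberSubfamily.1 (hDR₀.symm ▸ hF)).2
    have hR₁_c : ∀ F ∈ R₁, c ∉ F := fun F hF => (mem_memberSubfamily.1 (hDR₁.symm ▸ hF)).2
    -- for `K ∈ 𝒢₁`: `K ∈ 𝒢₀ ↔ K ∈ 𝒢`
    have h𝒢₀𝒢 : ∀ K ∈ 𝒢₁, K ∈ 𝒢₀ ↔ K ∈ 𝒢 := fun K hK => by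
      rw [mem_nonMemberSubfamily]; exact ⟨fun h => h.1, fun h => ⟨h, h𝒢₁_c K hK⟩⟩
    -- the new families lie in the new (convex) ambients
    have hUQ₀ : U ⊆ Q₀ := by
      intro K hK
      rcases mem_union.1 hK with h | h
      · exact mem_nonMemberSubfamily.2 ⟨h𝒢Q (mem_nonMemberSubfamily.1 h).1, (mem_nonMemberSubfamily.1 h).2⟩
      · exact mem_nonMemberSubfamily.2 ⟨(mem_filter.1 h).2, h𝒢₁_c K (mem_filter.1 h).1⟩
    have hIQ₁ : I ⊆ Q₁ := by
      intro K hK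
      have hK₁ := mem_memberSubfamily.1 (mem_filter.1 hK).1
      exact mem_memberSubfamily.2 ⟨h𝒢Q hK₁.1, hK₁.2⟩
    have hR₀Q₀ : R₀ ⊆ Q₀ := relDowns_subset Q₀ l U hUQ₀
    -- induction hypotheses with some bijections (cardinalities agree)
    have hcU : Fintype.card ↥U = Fintype.card ↥R₀ := by simp only [Fintype.card_coe, hR₀, card_relDowns]
    have hcI : Fintype.card ↥I = Fintype.card ↥R₁ := by simp only [Fintype.card_coe, hR₁, card_relDowns]
    let e₀ : ↥U ≃ ↥R₀ := Fintype.equivOfCardEq hcU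
    let e₁ : ↥I ≃ ↥R₁ := Fintype.equivOfCardEq hcI
    have ih₀ : IsUnit ((incl R₀ U).submatrix e₀ id).det :=
      isUnit_det_incl_relDowns l hl' Q₀ (convex_nonMemberSubfamily hQ c) U hUQ₀ e₀
    have ih₁ : IsUnit ((incl R₁ I).submatrix e₁ id).det :=
      isUnit_det_incl_relDowns l hl' Q₁ (convex_memberSubfamily hQ c) I hIQ₁ e₁
    -- the row map `U ⊕ I → D` and the column map `U ⊕ I → 𝒢`
    let ρ : ↥R₀ ⊕ ↥R₁ ≃ ↥D :=
      (Equiv.sumCongr (Equiv.subtypeEquivRight (fun F => by rw [hDR₀]))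
        (Equiv.subtypeEquivRight (fun F => by rw [hDR₁]))).symm.trans (sumEquiv c D)
    let f : ↥U ⊕ ↥I ≃ ↥D := (Equiv.sumCongr e₀ e₁).trans ρ
    let g : ↥U ⊕ ↥I ≃ ↥𝒢 := (relRegroup 𝒢 Q 𝒢₀ 𝒢₁ h𝒢₀𝒢).trans (sumEquiv c 𝒢)
    have hf_inl : ∀ u : ↥U, ((f (Sum.inl u) : ↥D) : Finset α) = (e₀ u : Finset α) := fun u => rfl
    have hf_inr : ∀ i : ↥I, ((f (Sum.inr i) : ↥D) : Finset α) = insert c (e₁ i : Finset α) := fun i => rfl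
    have hg_inl : ∀ u : ↥U, ((g (Sum.inl u) : ↥𝒢) : Finset α) =
        if (u : Finset α) ∈ 𝒢₀ then (u : Finset α) else insert c (u : Finset α) := by
      intro u
      by_cases h : (u : Finset α) ∈ 𝒢₀
      · simp only [g, Equiv.trans_apply]; rw [if_pos h]; simp [relRegroup, h]; rfl
      · simp only [g, Equiv.trans_apply]; rw [if_neg h]; simp [relRegroup, h]; rfl
    have hg_inr : ∀ i : ↥I, ((g (Sum.inr i) : ↥𝒢) : Finset α) = insert c (i : Finset α) := by
      intro i; simp only [g, Equiv.trans_apply]; simp [relRegroup]; rfl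
    -- the column operation: `E = 1 - N`, `N K K' = [K' = insert c K, c ∉ K]`
    set J : Finset (Finset α) := 𝒢₀ ∩ 𝒢₁ with hJ
    have hJ_c : ∀ K ∈ J, c ∉ K := fun K hK => (mem_nonMemberSubfamily.1 (mem_inter.1 hK).1).2
    let N : Matrix ↥𝒢 ↥𝒢 ℤ := Matrix.of fun K K' =>
      if (K' : Finset α) = insert c (K : Finset α) ∧ c ∉ (K : Finset α) then 1 else 0
    let A : Matrix ↥𝒢 ↥J ℤ := Matrix.of fun K i => if (K : Finset α) = (i : Finset α) then 1 else 0
    let B : Matrix ↥J ↥𝒢 ℤ := Matrix.of fun i K' => if (K' : Finset α) = insert c (i : Finset α) then 1 else 0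
    have hN : N = A * B := by
      ext K K'
      simp only [N, A, B, Matrix.mul_apply, Matrix.of_apply]
      by_cases h : (K' : Finset α) = insert c (K : Finset α) ∧ c ∉ (K : Finset α)
      · rw [if_pos h]
        have hKJ : (K : Finset α) ∈ J := by
          refine mem_inter.2 ⟨mem_nonMemberSubfamily.2 ⟨K.2, h.2⟩, mem_memberSubfamily.2 ⟨?_, h.2⟩⟩
          rw [← h.1]; exact K'.2
        rw [Finset.sum_eq_single ⟨K.1, hKJ⟩]
        · simp [h.1]
        · intro i _ hi
          have : (K : Finset α) ≠ (i : Finset α) := fun h' => hi (Subtype.ext h'.symm)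
          simp [this]
        · intro h'; exact absurd (Finset.mem_univ _) h'
      · rw [if_neg h]
        symm
        refine Finset.sum_eq_zero fun i _ => ?_
        by_cases h1 : (K : Finset α) = (i : Finset α)
        · have h2 : ¬ (K' : Finset α) = insert c (i : Finset α) := by
            intro h2; apply h; rw [← h1] at h2; exact ⟨h2, h1 ▸ hJ_c _ i.2⟩
          simp [h1, h2]
        · simp [h1]
    have hBA : B * A = 0 := by
      ext i i'
      simp only [Matrix.mul_apply, Matrix.of_apply, Matrix.zero_apply, A, B]
      refine Finset.sum_eq_zero fun K _ => ?_
      by_cases h1 : (K : Finset α) = insert c (i : Finset α)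
      · have h2 : ¬ insert c (i : Finset α) = (i' : Finset α) := by
          intro h2; apply hJ_c _ i'.2; rw [← h2]; exact mem_insert_self _ _
        simp [h1, h2]
      · simp [h1]
    have hdetE : (1 - N : Matrix ↥𝒢 ↥𝒢 ℤ).det = 1 := by
      rw [hN, Matrix.det_one_sub_mul_comm, hBA, sub_zero, Matrix.det_one]
    -- the main matrix identity: rows `f`, columns `g` of `X * (1 - N)` form a block lower-triangular matrix
    set X : Matrix ↥D ↥𝒢 ℤ := incl D 𝒢 with hX
    have hXN : ∀ (F : ↥D) (K' : ↥𝒢), (X * N) F K' =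
        if c ∈ (K' : Finset α) ∧ (K' : Finset α).erase c ∈ 𝒢 then
          (if (F : Finset α) ⊆ (K' : Finset α).erase c then 1 else 0) else 0 := by
      intro F K'
      simp only [Matrix.mul_apply, hX, incl_apply, N, Matrix.of_apply]
      by_cases h : c ∈ (K' : Finset α) ∧ (K' : Finset α).erase c ∈ 𝒢
      · rw [if_pos h, Finset.sum_eq_single ⟨(K' : Finset α).erase c, h.2⟩]
        · simp [insert_erase h.1]
        · intro K _ hK
          have : ¬ ((K' : Finset α) = insert c (K : Finset α) ∧ c ∉ (K : Finset α)) := by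
            rintro ⟨h1, h2⟩; apply hK; apply Subtype.ext; simp [h1, erase_insert h2]
          simp [this]
        · intro h'; exact absurd (Finset.mem_univ _) h'
      · rw [if_neg h]
        refine Finset.sum_eq_zero fun K _ => ?_
        have : ¬ ((K' : Finset α) = insert c (K : Finset α) ∧ c ∉ (K : Finset α)) := by
          rintro ⟨h1, h2⟩; apply h; rw [h1, erase_insert h2]; exact ⟨mem_insert_self _ _, K.2⟩
        simp [this]
    have hXE : ∀ (F : ↥D) (K' : ↥𝒢), (X * (1 - N) : Matrix ↥D ↥𝒢 ℤ) F K' =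
        (if (F : Finset α) ⊆ (K' : Finset α) then 1 else 0) -
        (if c ∈ (K' : Finset α) ∧ (K' : Finset α).erase c ∈ 𝒢 then
          (if (F : Finset α) ⊆ (K' : Finset α).erase c then 1 else 0) else 0) := by
      intro F K'
      rw [Matrix.mul_sub, Matrix.mul_one, Matrix.sub_apply, hXN, hX, incl_apply]
    let Y : Matrix (↥U ⊕ ↥I) (↥U ⊕ ↥I) ℤ := (X * (1 - N)).submatrix f g
    have hY : Y = Matrix.fromBlocks ((incl R₀ U).submatrix e₀ id) 0
        (Matrix.of fun i u => Y (Sum.inr i) (Sum.inl u)) ((incl R₁ I).submatrix e₁ id) := by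
      ext x y
      rcases x with u | i <;> rcases y with u' | i'
      · -- upper left block
        simp only [Y, submatrix_apply, Matrix.fromBlocks_apply₁₁, incl_apply, id_eq]
        rw [hXE, hf_inl, hg_inl]
        by_cases h0 : (u' : Finset α) ∈ 𝒢₀
        · have hc' : c ∉ (u' : Finset α) := hU_c _ u'.2
          rw [if_pos h0, if_neg (show ¬ (c ∈ (u' : Finset α) ∧ (u' : Finset α).erase c ∈ 𝒢) from fun h => hc' h.1),
            sub_zero]
        · have hc' : c ∉ (u' : Finset α) := hU_c _ u'.2
          have hcu : c ∉ (e₀ u : Finset α) := hR₀_c _ (e₀ u).2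
          have hne : ¬ (c ∈ insert c (u' : Finset α) ∧ (insert c (u' : Finset α)).erase c ∈ 𝒢) := by
            rintro ⟨-, h2⟩; apply h0; rw [erase_insert hc'] at h2; exact mem_nonMemberSubfamily.2 ⟨h2, hc'⟩
          rw [if_neg h0, if_neg hne, sub_zero]
          by_cases hs : (e₀ u : Finset α) ⊆ (u' : Finset α)
          · rw [if_pos hs, if_pos (hs.trans (subset_insert c _))]
          · rw [if_neg hs, if_neg (show ¬ ((e₀ u : Finset α) ⊆ insert c (u' : Finset α)) from
              fun h' => hs ((subset_insert_iff_of_notMem hcu).1 h'))]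
      · -- upper right block: zero
        simp only [Y, submatrix_apply, Matrix.fromBlocks_apply₁₂, Matrix.zero_apply]
        rw [hXE, hf_inl, hg_inr]
        have hi'1 : (i' : Finset α) ∈ 𝒢₁ := (mem_filter.1 i'.2).1
        have hc' : c ∉ (i' : Finset α) := hI_c _ i'.2
        have hcu : c ∉ (e₀ u : Finset α) := hR₀_c _ (e₀ u).2
        by_cases hiG : (i' : Finset α) ∈ 𝒢
        · -- `K = i' ∈ 𝒢⁰ ∩ 𝒢¹`: killed by the column operation
          have hyes : c ∈ insert c (i' : Finset α) ∧ (insert c (i' : Finset α)).erase c ∈ 𝒢 := by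
            refine ⟨mem_insert_self _ _, ?_⟩; rwa [erase_insert hc']
          rw [if_pos hyes, erase_insert hc']
          by_cases hs : (e₀ u : Finset α) ⊆ (i' : Finset α)
          · rw [if_pos hs, if_pos (hs.trans (subset_insert c _)), sub_self]
          · rw [if_neg hs, if_neg (show ¬ ((e₀ u : Finset α) ⊆ insert c (i' : Finset α)) from
              fun h' => hs ((subset_insert_iff_of_notMem hcu).1 h')), sub_zero]
        · -- `K = i' ∈ 𝒢¹ ∖ Q`: zero by CONVEXITY of the ambient (the extra remark)
          have hiQ : (i' : Finset α) ∉ Q := ((mem_filter.1 i'.2).2).resolve_left hiG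
          have hno : ¬ (c ∈ insert c (i' : Finset α) ∧ (insert c (i' : Finset α)).erase c ∈ 𝒢) := by
            rintro ⟨-, h2⟩; rw [erase_insert hc'] at h2; exact hiG h2
          rw [if_neg hno, sub_zero, if_neg]
          intro hsub
          have hsub' : (e₀ u : Finset α) ⊆ (i' : Finset α) := (subset_insert_iff_of_notMem hcu).1 hsub
          have hF : (e₀ u : Finset α) ∈ Q := (mem_nonMemberSubfamily.1 (hR₀Q₀ (e₀ u).2)).1
          have hG : insert c (i' : Finset α) ∈ Q := (mem_memberSubfamily.1 (hIQ₁ i'.2)).1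
          exact hiQ (hQ hF hG hsub' (subset_insert c _))
      · -- lower left block: by definition
        simp only [Matrix.fromBlocks_apply₂₁, Matrix.of_apply]
      · -- lower right block
        simp only [Y, submatrix_apply, Matrix.fromBlocks_apply₂₂, incl_apply, id_eq]
        rw [hXE, hf_inr, hg_inr]
        have hc' : c ∉ (i' : Finset α) := hI_c _ i'.2
        have hci : c ∉ (e₁ i : Finset α) := hR₁_c _ (e₁ i).2
        have hno : ¬ insert c (e₁ i : Finset α) ⊆ (i' : Finset α) := fun h => hc' (h (mem_insert_self _ _))
        have hzero : (if c ∈ insert c (i' : Finset α) ∧ (insert c (i' : Finset α)).erase c ∈ 𝒢 then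
            (if insert c (e₁ i : Finset α) ⊆ (insert c (i' : Finset α)).erase c then (1 : ℤ) else 0) else 0) = 0 := by
          rw [erase_insert hc', if_neg hno]; split_ifs <;> rfl
        rw [hzero, sub_zero]
        by_cases hs : (e₁ i : Finset α) ⊆ (i' : Finset α)
        · rw [if_pos hs, if_pos (insert_subset_insert c hs)]
        · rw [if_neg hs, if_neg (show ¬ (insert c (e₁ i : Finset α) ⊆ insert c (i' : Finset α)) from
            fun h' => hs ((subset_insert_iff_of_notMem hci).1 ((subset_insert c _).trans h')))]
    have hdetY : IsUnit Y.det := by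
      rw [hY, Matrix.det_fromBlocks_zero₁₂]
      exact ih₀.mul ih₁
    -- relate `Y` to the matrix of the statement
    have hrel : Y = (((X.submatrix e id) * (1 - N)).submatrix g g).submatrix (f.trans (e.symm.trans g.symm)) id := by
      ext x y
      simp only [Y, submatrix_apply, Matrix.mul_apply, id_eq, Equiv.trans_apply, Equiv.apply_symm_apply]
    rw [hrel, Matrix.det_permute, Matrix.det_submatrix_equiv_self, Matrix.det_mul, hdetE, mul_one] at hdetY
    exact (IsUnit.mul_iff.1 hdetY).2

end SahiFComb.Shift

end Summit.CriticalPhenomena.PercolationContinuityZ3.Theorems
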